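import Literature.MathematicalPhysics.QuantumFieldTheory.Balaban1983to89.HiggsDoubleRT
import Literature.MathematicalPhysics.QuantumFieldTheory.Balaban1983to89.B1Ineq337Proof

/-!
# `Balaban1983to89.B1Ineq337HiggsModel` — T. Bałaban, *(Higgs)₂,₃ quantum fields in a finite volume. I. A lower bound*,
Commun. Math. Phys. **85** (1982) 603–626 [Balaban1982Higgs1], **(3.37)** p. 618 FOR THE MODEL: the `(k+1)`-st lower-bound
step `Z^ε ≥ ∫dB∫dψ χ_{k+1}(B)χ_{k+1}(ψ) T^{L^kε}_{a,L}[T^{L^kε}_{a,L,A^{(k),ε}}[χ_k(A)χ_k(φ)exp(−S^{(k),L^kε}(A,φ))]]·exp(…)`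
with every transformation and every characteristic function CONCRETE — the double transformation of `…HiggsDoubleRT` at
the external field `A^{(k),ε}` of (3.29) (`B1Eq31Concrete.bgVec`), the printed `χ_k(A)`, `χ_k(φ)` (3.27)–(3.28)
(`B1Eq31Concrete.chiKA`, `chiKφ`) at level `k` inside and at level `k+1` outside — p14's abstract (3.37)
`B1Ineq337Proof.ineq337` with its three transformation hypotheses ((2.9), positivity, integrability) DISCHARGED

statement-level skeleton of published theorems with citation tags; proofs where landed; nothing here is a claim about the Yang–Mills mass gap

PDF held: `paper:balaban1982-cmp85-higgs23-i` (journal page = PDF page + 602).  (3.26)–(3.29) p. 617 and (3.37) p. 618 READ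
AS IMAGES on the ×2 renders `run/shared/lean/pub/pub-balaban/b2b-balaban-ref1/pages/1982-cmp85-higgs23-I/…-p015-x2.png`,
`…-p016-x2.png`; (2.9) p. 609 `…-p007-x2.png`.

CITATION HEADER (lean-in-tree rule).  lit-balaban typed skeleton (HOME `run/shared/lean/pub/lit-balaban/`), SKELETON row
**B1.Eq3.37-3.38**, the (3.37) member (owner r12; theorem of record = p14's `B1Ineq337Proof.ineq337` — the MECHANISM
*"From (3.26) and (2.9) we have (3.37)"* for an arbitrary integral-preserving positive transformation `T`; this module is
its INSTANCE for the model and uses it by name).  WHAT IS REPRODUCED.  p. 618 [PDF 16], verbatim: *"Now we will consider a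
general case, i.e. all the operations to be done after k+1^{st} application of the renormalization transformation. From
(3.26) and (2.9) we have Z^ε ≥ ∫dB∫dψ χ_{k+1}(B)χ_{k+1}(ψ)T^{L^kε}_{a,L}[T^{L^kε}_{a,L,A^{(k),ε}}[χ_k(A)χ_k(φ)
·exp(−S^{(k),L^kε}(A,φ))]] exp(Σ_{j=0}^{k−1} O(1)(L^jε)^{κ₀}|T_ε|) (3.37) and we have to calculate the internal integral
above."*  DICTIONARY: `T^{L^kε}_{a,L}[T^{L^kε}_{a,L,A^{(k),ε}}[ρ]]` = `HiggsDoubleRT.doubleRTk C a (A ↦ A^{(k),ε}) ρ` (the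
scalar-field transformation (2.4)–(2.7) at the external `ε`-lattice field `A^{(k),ε} = B1Eq31Concrete.bgVec μ₀² a k A`
of (3.29), then the vector-field transformation, p. 608); `χ_k(A)` = `chiKA ℓ₀ p₀ μ₀² a k` (3.27), `χ_k(φ)` =
`chiKφ C ℓ₀ p₀ μ₀² m² a k A φ` (3.28) (a function of `(A, φ)` through the background fields (3.29)); `χ_{k+1}(B)χ_{k+1}(ψ)`
= the same at level `k+1` and thresholds `(ℓ₁, p₁)`; `S^{(k),L^kε}` = ANY function `S` of the level-`k` fields with
`exp(−S) ∈ L¹(dA dφ)` — the effective action (3.30)–(3.36) is NOT constructed here (rows B1.Eq3.30–3.36), so the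
theorems hold for it in particular; the factor `exp(Σ_{j<k} O(1)(L^jε)^{κ₀}|T_ε|)` and `Z^ε` enter through r12's run
carrier `B1LowerBound.Run326` / `IndHyp326` exactly as in p14's file (the `O(1)`-sum read as the lower bound
`exp(−CΣ_{j<k}(L^jε)^{κ₀}|T_ε|)`).
PROVED: (§1) `a_k ≥ 0` for the model's parameters (so `χ_k(φ)` is jointly measurable, `HiggsCovarianceCont.measurable_chiK`);
(§2) the cut-off density `χ_k(A)χ_k(φ)exp(−S)` of (3.26) is non-negative, `≤ exp(−S)`, integrable; (§3) **(3.37)**: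
`lowerStep337` — `∫dB∫dψ χ_{k+1}(B)χ_{k+1}(ψ) T[T[χ_kχ_k e^{−S}]] ≤ ∫dA∫dφ χ_k(A)χ_k(φ)e^{−S}` ((2.9) for the model's
double transformation, `HiggsDoubleRT.integral_doubleRTk`, + the insertion of `χ_{k+1} ≤ 1`); `ineq337_model` — p14's
`ineq337` with `T`, `F` THE MODEL'S and its hypotheses `h29`/`hT0`/`hTint`/`hχ'` discharged, i.e. (3.37) as printed given
(3.26) at `k` for the run; `ineq337_model_family` — the same along a family of runs from `IndHyp326`.
HONEST SCOPE: (3.26) itself (the induction) and the identification of `S` with (3.30) are hypotheses (`h326`, `hdict`), as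
in the row's theorem of record; the rescaling (3.38) to the unit lattice is not treated (needs `HiggsRescaling`).
Unit `lit-balaban-typer` gen 3 (literature-prover-lit-balaban-typer-g3-0); HOME/FILED.md records the proposal.
-/

open scoped BigOperators
open _root_.MeasureTheory

namespace Literature.MathematicalPhysics.QuantumFieldTheory.Balaban1983to89.B1Ineq337HiggsModel

open Literature.MathematicalPhysics.QuantumFieldTheory.Balaban1983to89.HiggsLattice
open Literature.MathematicalPhysics.QuantumFieldTheory.Balaban1983to89.HiggsDoubleRT
open Literature.MathematicalPhysics.QuantumFieldTheory.Balaban1983to89.B1Eq31Concrete (bgVec chiKA chiKφ chiK_mem_Icc)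
open Literature.MathematicalPhysics.QuantumFieldTheory.Balaban1983to89.HiggsCovarianceCont (continuous_bgVec measurable_chiK)
open Literature.MathematicalPhysics.QuantumFieldTheory.Balaban1983to89.B1LowerBound (Run326 IndHyp326)
open Literature.MathematicalPhysics.QuantumFieldTheory.Balaban1983to89.B1Ineq337Proof (ineq337)
open Finset (range)

variable {P : Params} {N : ℕ}

/-! ## 1. The parameters: `a_k ≥ 0`, measurability of `A ↦ A^{(k),ε}` -/

/-- `a_k = a(1 − L^{−2})/(1 − L^{−2k}) ≥ 0` ((2.15) p. 609) for `a ≥ 0` and the model's `L ≥ 1` (for `k ≥ 1` it is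
`> 0`, `B1.aSeq_pos`; at `k = 0` the tree's value is `0`). [cite: Balaban1982Higgs1, (2.15) p.609] -/
theorem aSeq_nonneg {a : ℝ} (ha : 0 ≤ a) (k : ℕ) : 0 ≤ B1.aSeq a P.L k := by
  rw [B1.aSeq_eq]
  have hL : (1 : ℝ) ≤ (P.L : ℝ) := by exact_mod_cast P.hL
  have h1 : ((P.L : ℝ) ^ 2)⁻¹ ≤ 1 := inv_le_one_of_one_le₀ (one_le_pow₀ hL)
  have h0 : 0 ≤ ((P.L : ℝ) ^ 2)⁻¹ := inv_nonneg.2 (sq_nonneg _)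
  exact div_nonneg (mul_nonneg ha (sub_nonneg.2 h1)) (sub_nonneg.2 (pow_le_one₀ h0 h1))

/-- The external-field assignment `A ↦ A^{(k),ε}` (3.29) is measurable (it is linear, `HiggsCovarianceCont.continuous_bgVec`).
[cite: Balaban1982Higgs1, (3.29) p.617] -/
theorem measurable_bgVec (mu0sq a : ℝ) (k : ℕ) : Measurable fun A : VecField P k => bgVec (P := P) mu0sq a k A :=
  (continuous_bgVec mu0sq a k).measurable

/-! ## 2. The cut-off density `χ_k(A)χ_k(φ)exp(−S^{(k),L^kε}(A, φ))` of (3.26) -/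

section Density

/-- The integrand of the `k`-th cut-off integral (3.26) p. 617: `χ_k(A)χ_k(φ)exp(−S^{(k),L^kε}(A, φ))` with the printed
characteristic functions (3.27)–(3.28) at thresholds `(ℓ, p)` and a candidate effective action `S` (↤ `S^{(k),L^kε}`
(3.30)). [cite: Balaban1982Higgs1, (3.26) p.617] -/
noncomputable def cutoffDensity (C : ChargeData N) (ℓ p mu0sq msq a : ℝ) (k : ℕ)
    (S : VecField P k → ScalarField P k N → ℝ) (A : VecField P k) (φ : ScalarField P k N) : ℝ :=
  chiKA ℓ p mu0sq a k A * chiKφ C ℓ p mu0sq msq a k A φ * Real.exp (-S A φ)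

/-- The cut-off density is non-negative. [cite: Balaban1982Higgs1, (3.26) p.617] -/
theorem cutoffDensity_nonneg (C : ChargeData N) (ℓ p mu0sq msq a : ℝ) (k : ℕ)
    (S : VecField P k → ScalarField P k N → ℝ) (A : VecField P k) (φ : ScalarField P k N) :
    0 ≤ cutoffDensity C ℓ p mu0sq msq a k S A φ :=
  mul_nonneg (chiK_mem_Icc C ℓ p mu0sq msq a k A φ).1 (Real.exp_pos _).le

/-- The cut-off density is at most `exp(−S)` (`χ ≤ 1`). [cite: Balaban1982Higgs1, (3.26) p.617] -/
theorem cutoffDensity_le (C : ChargeData N) (ℓ p mu0sq msq a : ℝ) (k : ℕ)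
    (S : VecField P k → ScalarField P k N → ℝ) (A : VecField P k) (φ : ScalarField P k N) :
    cutoffDensity C ℓ p mu0sq msq a k S A φ ≤ Real.exp (-S A φ) :=
  mul_le_of_le_one_left (Real.exp_pos _).le (chiK_mem_Icc C ℓ p mu0sq msq a k A φ).2

/-- The cut-off density is integrable for `dA dφ` as soon as `exp(−S)` is (`a > 0`, `m² > 0`: the weight is jointly
measurable, `HiggsCovarianceCont.measurable_chiK`, and bounded by `1`). [cite: Balaban1982Higgs1, (3.26) p.617] -/
theorem integrable_cutoffDensity (C : ChargeData N) (ℓ p mu0sq : ℝ) {msq a : ℝ} (hmsq : 0 < msq) (ha : 0 < a) (k : ℕ)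
    {S : VecField P k → ScalarField P k N → ℝ}
    (hS : Integrable fun Φ : VecField P k × ScalarField P k N => Real.exp (-S Φ.1 Φ.2)) :
    Integrable fun Φ : VecField P k × ScalarField P k N => cutoffDensity C ℓ p mu0sq msq a k S Φ.1 Φ.2 := by
  unfold cutoffDensity
  refine hS.bdd_mul (c := 1) (measurable_chiK C ℓ p mu0sq hmsq a k (aSeq_nonneg ha.le k)).aestronglyMeasurable
    (Filter.Eventually.of_forall fun Φ => ?_)
  rw [Real.norm_of_nonneg (chiK_mem_Icc C ℓ p mu0sq msq a k Φ.1 Φ.2).1]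
  exact (chiK_mem_Icc C ℓ p mu0sq msq a k Φ.1 Φ.2).2

/-- The `k`-th cut-off integral is at most `∫dA∫dφ exp(−S)`. [cite: Balaban1982Higgs1, (3.26) p.617] -/
theorem integral_cutoffDensity_le (C : ChargeData N) (ℓ p mu0sq msq a : ℝ) (k : ℕ)
    {S : VecField P k → ScalarField P k N → ℝ}
    (hS : Integrable fun Φ : VecField P k × ScalarField P k N => Real.exp (-S Φ.1 Φ.2)) :
    ∫ Φ : VecField P k × ScalarField P k N, cutoffDensity C ℓ p mu0sq msq a k S Φ.1 Φ.2
      ≤ ∫ Φ : VecField P k × ScalarField P k N, Real.exp (-S Φ.1 Φ.2) :=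
  integral_mono_of_nonneg (Filter.Eventually.of_forall fun Φ => cutoffDensity_nonneg C ℓ p mu0sq msq a k S Φ.1 Φ.2) hS
    (Filter.Eventually.of_forall fun Φ => cutoffDensity_le C ℓ p mu0sq msq a k S Φ.1 Φ.2)

end Density

/-! ## 3. (3.37) for the model -/

section Step

/-- **(2.9) for the transformation of (3.37)**: `∫dB∫dψ T^{L^kε}_{a,L}[T^{L^kε}_{a,L,A^{(k),ε}}[ρ]] = ∫dA∫dφ ρ` for every
integrable density — `HiggsDoubleRT.integral_doubleRTk` at the external field `A^{(k),ε}`. [cite: Balaban1982Higgs1, (2.9) p.609] -/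
theorem integral_doubleRT337 {a : ℝ} (ha : 0 < a) (C : ChargeData N) (mu0sq : ℝ) (k : ℕ)
    {ρ : VecField P k → ScalarField P k N → ℝ} (hρ : Integrable fun Φ : VecField P k × ScalarField P k N => ρ Φ.1 Φ.2) :
    ∫ Ψ : VecField P (k + 1) × ScalarField P (k + 1) N,
        doubleRTk C a (fun A : VecField P k => bgVec mu0sq a k A) ρ Ψ.1 Ψ.2
      = ∫ Φ : VecField P k × ScalarField P k N, ρ Φ.1 Φ.2 :=
  integral_doubleRTk ha C (measurable_bgVec mu0sq a k) hρ

/-- **The integral inequality inside (3.37) p. 618, for the (Higgs)₂,₃ model**: for `a > 0`, `m² > 0`, any `μ₀²`, any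
thresholds `(ℓ₀, p₀)` at level `k` and `(ℓ₁, p₁)` at level `k+1`, and any `S` with `exp(−S) ∈ L¹(dA dφ)`:
`∫dB∫dψ χ_{k+1}(B)χ_{k+1}(ψ) T^{L^kε}_{a,L}[T^{L^kε}_{a,L,A^{(k),ε}}[χ_k(A)χ_k(φ)exp(−S(A,φ))]] ≤ ∫dA∫dφ χ_k(A)χ_k(φ)exp(−S(A,φ))`
— (2.9) for the double transformation and the insertion of `χ_{k+1} ≤ 1` against the non-negative transformed density.
PROVED. [cite: Balaban1982Higgs1, (3.37) p.618] -/
theorem lowerStep337 {a : ℝ} (ha : 0 < a) (C : ChargeData N) (mu0sq : ℝ) {msq : ℝ} (hmsq : 0 < msq) (k : ℕ)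
    {S : VecField P k → ScalarField P k N → ℝ}
    (hS : Integrable fun Φ : VecField P k × ScalarField P k N => Real.exp (-S Φ.1 Φ.2)) (ℓ₀ p₀ ℓ₁ p₁ : ℝ) :
    ∫ Ψ : VecField P (k + 1) × ScalarField P (k + 1) N,
        chiKA ℓ₁ p₁ mu0sq a (k + 1) Ψ.1 * chiKφ C ℓ₁ p₁ mu0sq msq a (k + 1) Ψ.1 Ψ.2
          * doubleRTk C a (fun A : VecField P k => bgVec mu0sq a k A) (cutoffDensity C ℓ₀ p₀ mu0sq msq a k S) Ψ.1 Ψ.2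
      ≤ ∫ Φ : VecField P k × ScalarField P k N, cutoffDensity C ℓ₀ p₀ mu0sq msq a k S Φ.1 Φ.2 :=
  integral_cutoff_doubleRTk_le ha C (measurable_bgVec mu0sq a k) (integrable_cutoffDensity C ℓ₀ p₀ mu0sq hmsq ha k hS)
    (cutoffDensity_nonneg C ℓ₀ p₀ mu0sq msq a k S)
    (χ' := fun B ψ => chiKA ℓ₁ p₁ mu0sq a (k + 1) B * chiKφ C ℓ₁ p₁ mu0sq msq a (k + 1) B ψ)
    fun B ψ => chiK_mem_Icc C ℓ₁ p₁ mu0sq msq a (k + 1) B ψ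

/-- The same with the right side weakened to `∫dA∫dφ exp(−S)` (drop `χ_k ≤ 1`; at `k = 0`, `S = S^ε` this is `Z^ε`, the
shape of (3.6)). [cite: Balaban1982Higgs1, (3.37) p.618] -/
theorem lowerStep337_le_exp {a : ℝ} (ha : 0 < a) (C : ChargeData N) (mu0sq : ℝ) {msq : ℝ} (hmsq : 0 < msq) (k : ℕ)
    {S : VecField P k → ScalarField P k N → ℝ}
    (hS : Integrable fun Φ : VecField P k × ScalarField P k N => Real.exp (-S Φ.1 Φ.2)) (ℓ₀ p₀ ℓ₁ p₁ : ℝ) :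
    ∫ Ψ : VecField P (k + 1) × ScalarField P (k + 1) N,
        chiKA ℓ₁ p₁ mu0sq a (k + 1) Ψ.1 * chiKφ C ℓ₁ p₁ mu0sq msq a (k + 1) Ψ.1 Ψ.2
          * doubleRTk C a (fun A : VecField P k => bgVec mu0sq a k A) (cutoffDensity C ℓ₀ p₀ mu0sq msq a k S) Ψ.1 Ψ.2
      ≤ ∫ Φ : VecField P k × ScalarField P k N, Real.exp (-S Φ.1 Φ.2) :=
  (lowerStep337 ha C mu0sq hmsq k hS ℓ₀ p₀ ℓ₁ p₁).trans (integral_cutoffDensity_le C ℓ₀ p₀ mu0sq msq a k hS)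

/-- **(3.37) p. 618 AS PRINTED, for the (Higgs)₂,₃ model**, along one run `R` of r12's carrier `B1LowerBound.Run326`:
if (3.26) holds at step `k` (`h326`, the `O(1)`-sum read as the lower bound `exp(−CΣ_{j<k}(L^jε)^{κ₀}|T_ε|)`) and the
run's `k`-th cut-off integral IS the model's `∫dA∫dφ χ_k(A)χ_k(φ)exp(−S(A,φ))` (`hdict`; `S` ↤ `S^{(k),L^kε}`), then
`(∫dB∫dψ χ_{k+1}(B)χ_{k+1}(ψ) T^{L^kε}_{a,L}[T^{L^kε}_{a,L,A^{(k),ε}}[χ_k(A)χ_k(φ)exp(−S)]])·exp(−CΣ_{j<k}(L^jε)^{κ₀}|T_ε|) ≤ Z^ε`.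
PROVED: p14's `B1Ineq337Proof.ineq337` with the transformation THE MODEL'S — its hypotheses (2.9) (`integral_doubleRT337`),
positivity (`HiggsDoubleRT.doubleRTk_nonneg`), integrability (`HiggsDoubleRT.integrable_doubleRTk`) and `0 ≤ χ_{k+1} ≤ 1`
(`B1Eq31Concrete.chiK_mem_Icc`) discharged. [cite: Balaban1982Higgs1, (3.37) p.618] -/
theorem ineq337_model {a : ℝ} (ha : 0 < a) (C : ChargeData N) (mu0sq : ℝ) {msq : ℝ} (hmsq : 0 < msq) (k : ℕ)
    {S : VecField P k → ScalarField P k N → ℝ}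
    (hS : Integrable fun Φ : VecField P k × ScalarField P k N => Real.exp (-S Φ.1 Φ.2)) (ℓ₀ p₀ ℓ₁ p₁ : ℝ)
    (R : Run326) {Cst κ₀ : ℝ}
    (h326 : R.intK k * Real.exp (-(Cst * (∑ i ∈ range k, (R.L ^ i * R.eps) ^ κ₀) * R.vol)) ≤ R.Z)
    (hdict : R.intK k = ∫ Φ : VecField P k × ScalarField P k N, cutoffDensity C ℓ₀ p₀ mu0sq msq a k S Φ.1 Φ.2) :
    (∫ Ψ : VecField P (k + 1) × ScalarField P (k + 1) N,
        chiKA ℓ₁ p₁ mu0sq a (k + 1) Ψ.1 * chiKφ C ℓ₁ p₁ mu0sq msq a (k + 1) Ψ.1 Ψ.2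
          * doubleRTk C a (fun A : VecField P k => bgVec mu0sq a k A) (cutoffDensity C ℓ₀ p₀ mu0sq msq a k S) Ψ.1 Ψ.2)
        * Real.exp (-(Cst * (∑ i ∈ range k, (R.L ^ i * R.eps) ^ κ₀) * R.vol))
      ≤ R.Z := by
  have hρ := integrable_cutoffDensity C ℓ₀ p₀ mu0sq hmsq ha k hS
  have h := ineq337 (μ := (volume : Measure (VecField P k × ScalarField P k N)))
    (ν := (volume : Measure (VecField P (k + 1) × ScalarField P (k + 1) N))) R k h326
    (fun (F : VecField P k × ScalarField P k N → ℝ) (bψ : VecField P (k + 1) × ScalarField P (k + 1) N) =>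
      doubleRTk C a (fun A : VecField P k => bgVec mu0sq a k A) (fun A φ => F (A, φ)) bψ.1 bψ.2)
    (F := fun Φ : VecField P k × ScalarField P k N => cutoffDensity C ℓ₀ p₀ mu0sq msq a k S Φ.1 Φ.2) hdict
    (integral_doubleRT337 ha C mu0sq k hρ)
    (fun bψ => doubleRTk_nonneg ha C _ (cutoffDensity_nonneg C ℓ₀ p₀ mu0sq msq a k S) bψ.1 bψ.2)
    (integrable_doubleRTk ha C (measurable_bgVec mu0sq a k) hρ)
    (χ' := fun bψ => chiKA ℓ₁ p₁ mu0sq a (k + 1) bψ.1 * chiKφ C ℓ₁ p₁ mu0sq msq a (k + 1) bψ.1 bψ.2)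
    fun bψ => chiK_mem_Icc C ℓ₁ p₁ mu0sq msq a (k + 1) bψ.1 bψ.2
  exact h

/-- **(3.37) along a family of runs** from the induction hypothesis of record `B1LowerBound.IndHyp326 fam` (ONE `C`, ONE
`κ₀ > 0` for all runs and steps): for every run `j`, every `k ≤ K_j`, every lattice datum and couplings of the model at
which the run's `k`-th cut-off integral is realised, the printed (3.37) bound holds with those constants.
[cite: Balaban1982Higgs1, (3.37) p.618] -/
theorem ineq337_model_family {J : Type} (fam : J → Run326) (hfam : IndHyp326 fam) :
    ∃ Cst κ₀ : ℝ, 0 < κ₀ ∧ ∀ (j : J) (k : ℕ), k ≤ (fam j).K →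
      ∀ (P : Params) (N : ℕ) (C : ChargeData N) (a : ℝ), 0 < a → ∀ (mu0sq msq : ℝ), 0 < msq →
        ∀ (S : VecField P k → ScalarField P k N → ℝ),
          (Integrable fun Φ : VecField P k × ScalarField P k N => Real.exp (-S Φ.1 Φ.2)) →
          ∀ (ℓ₀ p₀ ℓ₁ p₁ : ℝ),
            (fam j).intK k = ∫ Φ : VecField P k × ScalarField P k N, cutoffDensity C ℓ₀ p₀ mu0sq msq a k S Φ.1 Φ.2 →
            (∫ Ψ : VecField P (k + 1) × ScalarField P (k + 1) N,
                chiKA ℓ₁ p₁ mu0sq a (k + 1) Ψ.1 * chiKφ C ℓ₁ p₁ mu0sq msq a (k + 1) Ψ.1 Ψ.2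
                  * doubleRTk C a (fun A : VecField P k => bgVec mu0sq a k A)
                      (cutoffDensity C ℓ₀ p₀ mu0sq msq a k S) Ψ.1 Ψ.2)
                * Real.exp (-(Cst * (∑ i ∈ range k, ((fam j).L ^ i * (fam j).eps) ^ κ₀) * (fam j).vol))
              ≤ (fam j).Z := by
  obtain ⟨Cst, κ₀, hκ₀, hall⟩ := hfam
  exact ⟨Cst, κ₀, hκ₀, fun j k hk P N C a ha mu0sq msq hmsq S hS ℓ₀ p₀ ℓ₁ p₁ hdict =>
    ineq337_model ha C mu0sq hmsq k hS ℓ₀ p₀ ℓ₁ p₁ (fam j) (hall j k hk) hdict⟩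

end Step

end Literature.MathematicalPhysics.QuantumFieldTheory.Balaban1983to89.B1Ineq337HiggsModel
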